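import Summits.ValiantsHypothesis.ValiantsHypothesis.Theorems.LacunarySymmetroidMatrixDescartesPencilEnds
import Summits.ValiantsHypothesis.ValiantsHypothesis.Theorems.LacunarySymmetroidMatrixDescartesPivotColumnTwo
import Summits.ValiantsHypothesis.ValiantsHypothesis.Theorems.LacunarySymmetroidMatrixDescartesCensusPivotBridge

/-!
# `MatrixDescartes` census — pivot column: NO PIVOT PENCIL IS DESCARTES-SHARP
# (`PivotRootLawAt m K q (C(m+K, m) − 2)` for every size `m ≥ 2`, every `K ≥ 2`, every index `q`)

HONEST FRAMING.  Cell `pub-symmetroid`, seat `val-sym-mdr-p2` (gen 26); helper file `--supports` the crux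
`Theses.LacunarySymmetroid.MatrixDescartes` (OPEN), NO closure claim.  Pivot currency of `…CensusPivotDefs` (`pivotPosRoots`,
`PivotRootLawAt m K q B`: every pencil `X^e J + ∑ₖ X^{d k} P k`, `J` symmetric of index `≤ q`, `P k ⪰ 0`, has `Z₊ ≤ B`).  The kernel's
format-free upper row was the count-vector Descartes ceiling `Pivot.pivotRootLawAt_descartes : PivotRootLawAt m K q (C(m+K, m) − 1)`;
this file lowers it by one at every format with `m ≥ 2` and `K ≥ 2`:

**`pivotRootLawAt_choose_sub_two : 2 ≤ m → 2 ≤ K → PivotRootLawAt m K q (C(m+K, m) − 2)`** (every `q`; the index is not used).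

Sharp exceptions: `m = 1` (a V-shaped trinomial `p X^{d₁} + j X^e + q X^{d₂}` is Descartes-sharp) and `K = 1` (`det (J + y P)` has up to
`m = C(m+1, m) − 1` positive zeros in `y = X^{d−e}`).  PROOF (case analysis on the exponent configuration):
* `K = 2`: the tree's exact two-letter column `pivotRootLawAt_two_all : PivotRootLawAt m 2 q (2m)` and `2m ≤ C(m+2, m) − 2` (`m ≥ 2`);
* a TIE `d k₀ = d k₁` (`k₀ ≠ k₁`) or `d k = e`: merging the tied letters (`merge_letters`, `merge_pivot`: the same matrix pencil with one
  letter fewer; PSD + PSD is PSD, symmetric + PSD is symmetric) and the ceiling at `K − 1` letters, `C(m+K−1, m) − 1 ≤ C(m+K, m) − 2`;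
* no tie, `K ≥ 3`: two PSD letters lie strictly on one side of the pivot, i.e. on the two strictly SMALLEST or the two strictly LARGEST
  exponents of the `(K+1)`-letter pencil (`Pivot.pivot_pencil_eq_cons`), and the companions' end laws apply
  (`WLawNotSharp.card_posRoots_det_pencil_le_of_bot_two_posSemidef`, `PencilEnds.card_posRoots_det_pencil_le_of_top_two_posSemidef`:
  the two end coefficients `det P`, `tr (adj P · P′)` are `≥ 0` and adjacent in exponent order).
Nothing here bears on `MatrixDescartes` in its window, on `stub_twoSided`, on `DoorA26` / `DoorA34`, on the cell's registers, or on `VP ≠ VNP`.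

[folklore] Bookkeeping over the companions and the tree (`stub_descartesCeiling`, `pivotRootLawAt_two_all`, `pivot_pencil_eq_cons`).  No
definitions, no named facts.
-/

-- `Summit.ValiantsHypothesis.ValiantsHypothesis.…` repeats a component by the single-conjunct
-- summit layout, which the `dupNamespace` linter flags; the name is mandated.
set_option linter.dupNamespace false

namespace Summit.ValiantsHypothesis.ValiantsHypothesis.Theorems.LacunarySymmetroidMatrixDescartes

open Polynomial Finset Matrix TrailingCoeffs WLawNotSharp PencilEnds Pivot
open scoped BigOperators Polynomial Matrix

namespace PivotNotSharp

variable {m K : ℕ}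

/-! ### 1. Merging tied letters -/

/-- **Merging two PSD letters with the same exponent**: `K' + 1` letters with `d k₁ = d k₀` (`k₀ = k₁.succAbove j₀`) give the same matrix pencil as the
`K'` letters `k₁.succAbove j` with `P k₁` added to the letter `k₀`. [folklore] -/
theorem merge_letters (e : ℕ) (d : Fin (K + 1) → ℕ) (J : Matrix (Fin m) (Fin m) ℝ) (P : Fin (K + 1) → Matrix (Fin m) (Fin m) ℝ)
    {k₀ k₁ : Fin (K + 1)} (hd : d k₁ = d k₀) {j₀ : Fin K} (hj₀ : k₁.succAbove j₀ = k₀) :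
    ((X : ℝ[X]) ^ e) • J.map C + ∑ k, ((X : ℝ[X]) ^ d k) • (P k).map C
      = ((X : ℝ[X]) ^ e) • J.map C + ∑ j : Fin K, ((X : ℝ[X]) ^ d (k₁.succAbove j)) •
          (Function.update (fun j => P (k₁.succAbove j)) j₀ (P k₀ + P k₁) j).map C := by
  congr 1
  rw [Fin.sum_univ_succAbove _ k₁]
  have hsplit : ∀ j : Fin K, ((X : ℝ[X]) ^ d (k₁.succAbove j)) •
      (Function.update (fun j => P (k₁.succAbove j)) j₀ (P k₀ + P k₁) j).map C
      = ((X : ℝ[X]) ^ d (k₁.succAbove j)) • (P (k₁.succAbove j)).map C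
        + (if j = j₀ then ((X : ℝ[X]) ^ d k₁) • (P k₁).map C else 0) := by
    intro j
    by_cases hj : j = j₀
    · subst hj
      rw [Function.update_self, if_pos rfl, hj₀, Matrix.map_add _ (fun _ _ => Polynomial.C_add), smul_add, hd]
    · rw [Function.update_of_ne hj, if_neg hj, add_zero]
  simp_rw [hsplit]
  rw [Finset.sum_add_distrib, Finset.sum_ite_eq' Finset.univ j₀, if_pos (Finset.mem_univ _), add_comm]

/-- **Merging a PSD letter into the pivot** (`d k₁ = e`): the same matrix pencil with pivot letter `J + P k₁` and the `K'` letters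
`k₁.succAbove j`. [folklore] -/
theorem merge_pivot (e : ℕ) (d : Fin (K + 1) → ℕ) (J : Matrix (Fin m) (Fin m) ℝ) (P : Fin (K + 1) → Matrix (Fin m) (Fin m) ℝ)
    {k₁ : Fin (K + 1)} (hd : d k₁ = e) :
    ((X : ℝ[X]) ^ e) • J.map C + ∑ k, ((X : ℝ[X]) ^ d k) • (P k).map C
      = ((X : ℝ[X]) ^ e) • (J + P k₁).map C + ∑ j : Fin K, ((X : ℝ[X]) ^ d (k₁.succAbove j)) • (P (k₁.succAbove j)).map C := by
  rw [Fin.sum_univ_succAbove _ k₁, hd, Matrix.map_add _ (fun _ _ => Polynomial.C_add), smul_add, add_assoc]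

/-- After a merge the ceiling at `K` letters applies: `Z₊ ≤ C(m+K, m) − 1 ≤ C(m+K+1, m) − 2` (`m ≥ 1`). [bookkeeping] -/
theorem choose_step (hm : 1 ≤ m) (K : ℕ) : Nat.choose (m + K) m - 1 ≤ Nat.choose (m + (K + 1)) m - 2 := by
  have h := Nat.succ_sub_one m ▸ (Nat.choose_succ_succ' (m + K) (m - 1))
  have hm' : m - 1 + 1 = m := Nat.sub_add_cancel hm
  have hrec : Nat.choose (m + (K + 1)) m = Nat.choose (m + K) (m - 1) + Nat.choose (m + K) m := by
    rw [show m + (K + 1) = (m + K) + 1 by ring]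
    conv_lhs => rw [← hm']
    rw [Nat.choose_succ_succ', hm']
  have hpos : 1 ≤ Nat.choose (m + K) (m - 1) := Nat.choose_pos (by omega)
  omega

/-! ### 2. The two smallest / two largest PSD exponents -/

/-- If at least two PSD exponents lie strictly below the pivot and all `K + 1` exponents are distinct, the two smallest exponents of the
`(K+1)`-letter pencil `Fin.cons e d` / `Fin.cons J P` are carried by PSD letters, and the bottom end law gives `Z₊ ≤ C(m+1+K, m+1) − 2`.
[folklore] -/
theorem le_of_two_below (e : ℕ) (d : Fin K → ℕ) (J : Matrix (Fin (m + 1)) (Fin (m + 1)) ℝ)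
    (P : Fin K → Matrix (Fin (m + 1)) (Fin (m + 1)) ℝ) (hP : ∀ k, (P k).PosSemidef) (hinj : Function.Injective d)
    {k₀ k₁ : Fin K} (hk : k₀ ≠ k₁) (h0 : ∀ k, d k₀ ≤ d k) (h1 : ∀ k, k ≠ k₀ → d k₁ ≤ d k)
    (hk₁e : d k₁ < e) :
    pivotPosRoots e d J P ≤ Nat.choose (m + 1 + K) (m + 1) - 2 := by
  unfold pivotPosRoots
  rw [pivot_pencil_eq_cons]
  have h01 : d k₀ < d k₁ := lt_of_le_of_ne (h0 k₁) (fun h => hk (hinj h))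
  have hK : m + 1 + (K + 1) - 1 = m + 1 + K := by omega
  rw [← hK]
  refine card_posRoots_det_pencil_le_of_bot_two_posSemidef (Nat.succ_pos K) (Fin.cons e d) (Fin.cons J P)
    (l₀ := k₀.succ) (l₁ := k₁.succ) ?_ ?_ ?_ ?_ ?_
  · simpa only [Fin.cons_succ] using h01
  · intro l hl
    refine Fin.cases ?_ (fun k hk' => ?_) l hl
    · intro _; simpa only [Fin.cons_zero, Fin.cons_succ] using h01.trans hk₁e
    · simp only [Fin.cons_succ]
      have hne : k ≠ k₀ := fun h => hk' (by rw [h])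
      exact lt_of_le_of_ne (h0 k) (fun h => hne (hinj h).symm)
  · intro l hl hl'
    refine Fin.cases ?_ (fun k hk' hk'' => ?_) l hl hl'
    · intro _ _; simpa only [Fin.cons_zero, Fin.cons_succ] using hk₁e
    · simp only [Fin.cons_succ]
      have hne₀ : k ≠ k₀ := fun h => hk' (by rw [h])
      have hne₁ : k ≠ k₁ := fun h => hk'' (by rw [h])
      exact lt_of_le_of_ne (h1 k hne₀) (fun h => hne₁ (hinj h).symm)
  · simpa only [Fin.cons_succ] using hP k₀
  · simpa only [Fin.cons_succ] using hP k₁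

/-- Mirror: at least two PSD exponents strictly above the pivot, all exponents distinct ⇒ `Z₊ ≤ C(m+1+K, m+1) − 2` (top end law). [folklore] -/
theorem le_of_two_above (e : ℕ) (d : Fin K → ℕ) (J : Matrix (Fin (m + 1)) (Fin (m + 1)) ℝ)
    (P : Fin K → Matrix (Fin (m + 1)) (Fin (m + 1)) ℝ) (hP : ∀ k, (P k).PosSemidef) (hinj : Function.Injective d)
    {k₀ k₁ : Fin K} (hk : k₀ ≠ k₁) (h0 : ∀ k, d k ≤ d k₀) (h1 : ∀ k, k ≠ k₀ → d k ≤ d k₁)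
    (hk₁e : e < d k₁) :
    pivotPosRoots e d J P ≤ Nat.choose (m + 1 + K) (m + 1) - 2 := by
  unfold pivotPosRoots
  rw [pivot_pencil_eq_cons]
  have h01 : d k₁ < d k₀ := lt_of_le_of_ne (h0 k₁) (fun h => hk (hinj h).symm)
  have hK : m + 1 + (K + 1) - 1 = m + 1 + K := by omega
  rw [← hK]
  refine card_posRoots_det_pencil_le_of_top_two_posSemidef (Nat.succ_pos K) (Fin.cons e d) (Fin.cons J P)
    (k₀ := k₀.succ) (k₁ := k₁.succ) ?_ ?_ ?_ ?_ ?_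
  · simpa only [Fin.cons_succ] using h01
  · intro l hl
    refine Fin.cases ?_ (fun k hk' => ?_) l hl
    · intro _; simpa only [Fin.cons_zero, Fin.cons_succ] using hk₁e.trans h01
    · simp only [Fin.cons_succ]
      have hne : k ≠ k₀ := fun h => hk' (by rw [h])
      exact lt_of_le_of_ne (h0 k) (fun h => hne (hinj h))
  · intro l hl hl'
    refine Fin.cases ?_ (fun k hk' hk'' => ?_) l hl hl'
    · intro _ _; simpa only [Fin.cons_zero, Fin.cons_succ] using hk₁e
    · simp only [Fin.cons_succ]
      have hne₀ : k ≠ k₀ := fun h => hk' (by rw [h])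
      have hne₁ : k ≠ k₁ := fun h => hk'' (by rw [h])
      exact lt_of_le_of_ne (h1 k hne₀) (fun h => hne₁ (hinj h))
  · simpa only [Fin.cons_succ] using hP k₀
  · simpa only [Fin.cons_succ] using hP k₁

/-! ### 3. The row -/

/-- `2m ≤ C(m+2, m) − 2` for `m ≥ 2`. [bookkeeping] -/
theorem two_mul_le_choose_sub_two (hm : 2 ≤ m) : 2 * m ≤ Nat.choose (m + 2) m - 2 := by
  have h1 : Nat.choose (m + 2) m = (m + 2) * (m + 1) / 2 := by
    rw [Nat.choose_symm_add, Nat.choose_two_right]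
    congr 1
  have h2 : 2 * m + 2 ≤ (m + 2) * (m + 1) / 2 := by
    rw [Nat.le_div_iff_mul_le (by norm_num)]; nlinarith
  omega

/-- **NO PIVOT PENCIL IS DESCARTES-SHARP.**  For every size `m ≥ 2`, every number `K ≥ 2` of PSD letters and every index `q`:
`PivotRootLawAt m K q (C(m+K, m) − 2)` — one below the count-vector ceiling `Pivot.pivotRootLawAt_descartes`. [folklore] -/
theorem pivotRootLawAt_choose_sub_two (hm : 2 ≤ m) (hK : 2 ≤ K) (q : ℕ) : PivotRootLawAt m K q (Nat.choose (m + K) m - 2) := by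
  classical
  -- `K = 2`: the exact two-letter column
  rcases Nat.eq_or_lt_of_le hK with rfl | hK3
  · exact pivotRootLawAt_mono (pivotRootLawAt_two_all m q) (two_mul_le_choose_sub_two hm)
  obtain ⟨m', rfl⟩ : ∃ m', m = m' + 1 := ⟨m - 1, by omega⟩
  obtain ⟨K', rfl⟩ : ∃ K', K = K' + 1 := ⟨K - 1, by omega⟩
  intro e d J P hJ hP _
  -- ties among the PSD letters
  by_cases hinj : Function.Injective d
  swap
  · obtain ⟨k₀, k₁, hd, hne⟩ := Function.not_injective_iff.mp hinj
    obtain ⟨j₀, hj₀⟩ := Fin.exists_succAbove_eq hne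
    unfold pivotPosRoots
    rw [merge_letters e d J P hd.symm hj₀]
    have hc := stub_descartesCeiling (K' + 1) (m' + 1) (Nat.succ_pos K') (Fin.cons e (fun j => d (k₁.succAbove j)))
      (Fin.cons J (Function.update (fun j => P (k₁.succAbove j)) j₀ (P k₀ + P k₁)))
    rw [← pivot_pencil_eq_cons, show m' + 1 + (K' + 1) - 1 = m' + 1 + K' by omega] at hc
    have hstep := choose_step (m := m' + 1) (by omega) K'
    omega
  -- a tie with the pivot exponent
  by_cases hpiv : ∃ k, d k = e
  · obtain ⟨k₁, hk₁⟩ := hpiv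
    unfold pivotPosRoots
    rw [merge_pivot e d J P hk₁]
    have hc := stub_descartesCeiling (K' + 1) (m' + 1) (Nat.succ_pos K') (Fin.cons e (fun j => d (k₁.succAbove j)))
      (Fin.cons (J + P k₁) (fun j => P (k₁.succAbove j)))
    rw [← pivot_pencil_eq_cons, show m' + 1 + (K' + 1) - 1 = m' + 1 + K' by omega] at hc
    have hstep := choose_step (m := m' + 1) (by omega) K'
    omega
  push Not at hpiv
  -- the minimum and the maximum of `d`, and the runners-up
  obtain ⟨kmin, -, hmin⟩ := Finset.exists_min_image Finset.univ d (Finset.univ_nonempty_iff.mpr ⟨0⟩)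
  obtain ⟨kmax, -, hmax⟩ := Finset.exists_max_image Finset.univ d (Finset.univ_nonempty_iff.mpr ⟨0⟩)
  have hne' : (Finset.univ.erase kmin : Finset (Fin (K' + 1))).Nonempty := by
    rw [← Finset.card_pos, Finset.card_erase_of_mem (Finset.mem_univ _), Finset.card_univ, Fintype.card_fin]; omega
  have hne'' : (Finset.univ.erase kmax : Finset (Fin (K' + 1))).Nonempty := by
    rw [← Finset.card_pos, Finset.card_erase_of_mem (Finset.mem_univ _), Finset.card_univ, Fintype.card_fin]; omega
  obtain ⟨kmin₂, hkmin₂, hmin₂⟩ := Finset.exists_min_image _ d hne'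
  obtain ⟨kmax₂, hkmax₂, hmax₂⟩ := Finset.exists_max_image _ d hne''
  have hkmin₂ne : kmin₂ ≠ kmin := (Finset.mem_erase.mp hkmin₂).1
  have hkmax₂ne : kmax₂ ≠ kmax := (Finset.mem_erase.mp hkmax₂).1
  -- either the second smallest exponent is below the pivot or the second largest is above it
  by_cases hlow : d kmin₂ < e
  · exact le_of_two_below e d J P hP hinj hkmin₂ne.symm (fun k => hmin k (Finset.mem_univ _))
      (fun k hk => hmin₂ k (Finset.mem_erase.mpr ⟨hk, Finset.mem_univ _⟩)) hlow
  by_cases hhigh : e < d kmax₂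
  · exact le_of_two_above e d J P hP hinj hkmax₂ne.symm (fun k => hmax k (Finset.mem_univ _))
      (fun k hk => hmax₂ k (Finset.mem_erase.mpr ⟨hk, Finset.mem_univ _⟩)) hhigh
  -- otherwise at most one letter lies below and at most one above: impossible for `K ≥ 3` distinct exponents
  exfalso
  push Not at hlow hhigh
  have hlow' : e < d kmin₂ := lt_of_le_of_ne hlow (hpiv kmin₂).symm
  have hhigh' : d kmax₂ < e := lt_of_le_of_ne hhigh (hpiv kmax₂)
  -- every `k ≠ kmin` has `d k > e` and every `k ≠ kmax` has `d k < e`; with `K ≥ 3` pick `k ∉ {kmin, kmax}`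
  have hcard : 2 < (Finset.univ : Finset (Fin (K' + 1))).card := by rw [Finset.card_univ, Fintype.card_fin]; omega
  obtain ⟨k, hk, hk1, hk2⟩ : ∃ k ∈ (Finset.univ : Finset (Fin (K' + 1))), k ≠ kmin ∧ k ≠ kmax := by
    have h3 : 0 < ((Finset.univ.erase kmin).erase kmax : Finset (Fin (K' + 1))).card := by
      have := Finset.card_erase_add_one (Finset.mem_univ kmin) ▸ hcard
      have h1 : ((Finset.univ : Finset (Fin (K' + 1))).erase kmin).card = (Finset.univ : Finset (Fin (K' + 1))).card - 1 :=
        Finset.card_erase_of_mem (Finset.mem_univ _)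
      have h2 := Finset.card_erase_le (s := (Finset.univ : Finset (Fin (K' + 1))).erase kmin) (a := kmax)
      by_cases hm2 : kmax ∈ (Finset.univ : Finset (Fin (K' + 1))).erase kmin
      · rw [Finset.card_erase_of_mem hm2, h1]; omega
      · rw [Finset.erase_eq_of_notMem hm2, h1]; omega
    obtain ⟨k, hk⟩ := Finset.card_pos.mp h3
    exact ⟨k, Finset.mem_univ _, (Finset.mem_erase.mp (Finset.mem_erase.mp hk).2).1, (Finset.mem_erase.mp hk).1⟩
  have h1 : e < d k := hlow'.trans_le (hmin₂ k (Finset.mem_erase.mpr ⟨hk1, Finset.mem_univ _⟩))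
  have h2 : d k < e := (hmax₂ k (Finset.mem_erase.mpr ⟨hk2, Finset.mem_univ _⟩)).trans_lt hhigh'
  exact lt_irrefl _ (h1.trans h2)

end PivotNotSharp

/-- **NO PIVOT PENCIL IS DESCARTES-SHARP** (root namespace alias of `PivotNotSharp.pivotRootLawAt_choose_sub_two`): for `m ≥ 2`, `K ≥ 2` and
every index `q`, `PivotRootLawAt m K q (C(m+K, m) − 2)`. [folklore] -/
theorem Pivot.pivotRootLawAt_choose_sub_two {m K : ℕ} (hm : 2 ≤ m) (hK : 2 ≤ K) (q : ℕ) :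
    Pivot.PivotRootLawAt m K q (Nat.choose (m + K) m - 2) :=
  PivotNotSharp.pivotRootLawAt_choose_sub_two hm hK q

end Summit.ValiantsHypothesis.ValiantsHypothesis.Theorems.LacunarySymmetroidMatrixDescartes
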